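import Mathlib.Topology.Algebra.MulAction
import Mathlib.RingTheory.DedekindDomain.Factorization
import Literature.NumberTheory.EllipticCurves.Selmer
import Literature.NumberTheory.GaloisRepresentations.IntegralGaloisAction
import Literature.NumberTheory.DiophantineGeometry.LocalReduction
import HarnessLib

/-!
# Unramified cohomology classes and the finiteness of the Selmer group (Silverman AEC X.4.2–4.4)

D-0014 decomposition file for the named fact `WeierstrassCurve.finite_selmerGroup`
(`Literature.NumberTheory.EllipticCurves.Selmer`; Silverman, *AEC*, Thm. X.4.2(b): the `n`-Selmer
group of an elliptic curve over a number field is finite). Silverman's proof (2nd ed., pp. 286–287)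
has exactly two steps, which this file vendors as named facts, together with the *proved* assembly
of X.4.2(b) from them:

* **Cor. X.4.4** (`WeierstrassCurve.selmerGroup_le_h1Unramified`): if `S` contains the places of
  bad reduction and the places dividing `n`, then `Sel^(n)(E/K) ⊆ H¹(G_K, E[n]; S)`, the subgroup of
  classes unramified outside `S` (proof: local Kummer sequence, reduction modulo `v`, injectivity of
  prime-to-`v` torsion under reduction VII.3.1/VIII.1.4, inertia acts trivially on `Ẽ_v`).
* **Lemma X.4.3** (`Literature.NumberTheory.EllipticCurves.finite_h1Unramified`): for a finite discrete `G_K`-module `M` with continuous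
  action and a finite set of places `S`, `H¹(G_K, M; S)` is finite (proof: inflation–restriction
  B.2.4 and VIII.1.6, finiteness of the maximal abelian extension of exponent `m` unramified
  outside `S`, i.e. Kummer theory + finiteness of the class group + Dirichlet's `S`-unit theorem).
* **Thm. X.4.2(b)** assembled: `WeierstrassCurve.finite_selmerGroup_of_le_h1Unramified` proves
  `finite_selmerGroup W` from the two facts above and the (already vendored) named facts
  `finite_badPlaces` (`LocalReduction`), `finite_torsionPoints` and `isOpen_stabilizer_point`
  (`GaloisAction`); the set `S = bad places ∪ {v : v(n) > 0}` is finite by Mathlib's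
  `Ideal.finite_factors`.

To state these we define (Silverman, *AEC*, VIII.§2, Definition p. 191, and X.4.3):

* `Literature.subgroupResKer M H ⊆ H¹(G, M)`: the kernel of the restriction `H¹(G, M) → H¹(H, M)` to a
  subgroup `H ≤ G` (Mathlib's `ContinuousCohomology.map` along the inclusion `H →ₜ* G`, via the
  generic `Literature.NumberTheory.EllipticCurves.resKer` of `GaloisAction`);
* `Literature.unramifiedKer M 𝔓 ⊆ H¹(G_K, M)`: the classes *unramified at* `𝔓`, i.e. restricting to `0` in
  `H¹(I_𝔓, M)`, where `I_𝔓 = 𝔓.inertia G_K` (Mathlib's `Ideal.inertia`) is the inertia group of a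
  prime `𝔓` of `\bar ℤ_K = Literature.absIntegers (𝓞 K) K` (`IntegralGaloisAction`);
* `Literature.h1Unramified M S = H¹(G_K, M; S)`: the classes unramified at every prime `𝔓` above every
  finite place `v ∉ S` (intersection over *all* `𝔓 ∣ v`, which avoids the choice of an extension of
  `v` to `K̄`; Silverman remarks (VIII.§2, X.4.1.1) that the condition does not depend on it).

Sources: J. H. Silverman, *The Arithmetic of Elliptic Curves*, 2nd ed. (2009), VIII.§2 (p. 191),
X.§4 (Thm. 4.2, Lemma 4.3, Cor. 4.4, pp. 285–287); J. S. Milne, *Arithmetic Duality Theorems*,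
I.§6 (Lemma 6.6 ff.).

## Mathlib reuse

`Ideal.inertia`, `Subgroup.subtype` (+ `continuous_subtype_val`) as a `ContinuousMonoidHom`,
`ContinuousCohomology.map` (through `Literature.NumberTheory.EllipticCurves.resKer`), `continuousSMul_iff_stabilizer_isOpen`,
`Ideal.finite_factors`, `Ideal.dvd_span_singleton`, `AddSubgroup.inclusion_injective`.
Mathlib has no unramified-classes / `H¹(G, M; S)` notion (grep `unramified` in
`RepresentationTheory`, `NumberTheory`: only ramification of ideals/valuations).

## Design choices

* Group-wide rules of `Selmer`/`Sha`: `noncomputable section`, `open scoped Classical`, one named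
  universe `u` with `K M : Type u` (forced by `ContinuousCohomology.map`).
* `S` is a set of *finite* places `Set (HeightOneSpectrum (𝓞 K))`; the infinite places impose no
  unramifiedness condition (as in Silverman, where `S ⊇ M_K^∞` in X.4.4 and `S` may be enlarged in
  X.4.3), so they are implicitly in `S`.
* `finite_h1Unramified K` quantifies over the module `M : Type u` *inside* the `Prop`, so that a user
  holds a single hypothesis `(h : Literature.finite_h1Unramified K)`; the continuity hypothesis of Silverman's
  standing convention on `G_K`-modules (App. B) is `[ContinuousSMul (Field.absoluteGaloisGroup K) M]`
  for the discrete topology on `M` (equivalently, open stabilizers: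
  `continuousSMul_iff_stabilizer_isOpen`).
* In X.4.4 the isogeny is `φ = [n]`, `deg φ = n²`, and `v(n²) > 0 ↔ v(n) > 0 ↔ (n : 𝓞 K) ∈ v`.
-/

noncomputable section

open scoped Classical
open scoped AddSubgroup

open NumberField IsDedekindDomain

universe u

namespace Literature.NumberTheory.EllipticCurves

/-! ## Restriction to a subgroup and its kernel -/

section Restriction

variable {G : Type u} [Group G] [TopologicalSpace G]

/-- The inclusion `H ↪ G` of a subgroup of a topological group as a continuous monoid
homomorphism (`Subgroup.subtype` with `continuous_subtype_val`).
Serre, *Galois Cohomology*, I.§2.4 (restriction). [folklore] -/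
def subgroupIncl (H : Subgroup G) : H →ₜ* G where
  toMonoidHom := H.subtype
  continuous_toFun := continuous_subtype_val

/-- Unfolding `subgroupIncl`. Serre, *Galois Cohomology*, I.§2.4. [folklore] -/
@[simp]
theorem subgroupIncl_apply (H : Subgroup G) (x : H) : subgroupIncl H x = (x : G) :=
  rfl

variable [IsTopologicalGroup G]
variable (M : Type u) [AddCommGroup M] [DistribMulAction G M] [TopologicalSpace M]
  [DiscreteTopology M]

/-- The kernel of the restriction map `res : H¹(G, M) → H¹(H, M)` to a subgroup `H ≤ G` of the
discrete `G`-module `M` (`Literature.NumberTheory.EllipticCurves.resKer` along the compatible pair `(H ↪ G, id_M)`).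
Serre, *Galois Cohomology*, I.§2.4; Silverman, *AEC*, App. B.§2. [folklore] -/
def subgroupResKer (H : Subgroup G) : AddSubgroup (discreteH1 G M) :=
  resKer (subgroupIncl H) (AddMonoidHom.id M) fun _ _ ↦ rfl

end Restriction

/-! ## Classes unramified at a prime, and `H¹(G_K, M; S)` -/

section Unramified

variable {K : Type u} [Field K]
variable (M : Type u) [AddCommGroup M] [DistribMulAction (Field.absoluteGaloisGroup K) M]
  [TopologicalSpace M] [DiscreteTopology M]

/-- The subgroup of classes of `H¹(G_K, M)` **unramified at** the prime `𝔓` of `\bar ℤ_K`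
(`Literature.absIntegers (𝓞 K) K`): those whose restriction to `H¹(I_𝔓, M)` is trivial, where
`I_𝔓 = 𝔓.inertia G_K ⊆ G_K` is the inertia group of `𝔓` (an inertia group of the place below `𝔓`).
Silverman, *AEC*, VIII.§2, Definition (p. 191). [cite: SilvermanAEC2009, VIII.§2 Definition p. 191] -/
def unramifiedKer (𝔓 : Ideal (GaloisRepresentations.absIntegers (𝓞 K) K)) :
    AddSubgroup (discreteH1 (Field.absoluteGaloisGroup K) M) :=
  subgroupResKer M (𝔓.inertia (Field.absoluteGaloisGroup K))

/-- **`H¹(G_K, M; S)`**: the subgroup of classes of `H¹(G_K, M)` unramified outside the set `S` of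
finite places, i.e. unramified at every prime `𝔓` of `\bar ℤ_K` above every finite place `v ∉ S`
(`v.primesAbove`). Silverman, *AEC*, X.§4, Lemma 4.3 (definition of `H¹(G_{K̄/K}, M; S)`).
[cite: SilvermanAEC2009, Lemma X.4.3] -/
def h1Unramified (S : Set (HeightOneSpectrum (𝓞 K))) :
    AddSubgroup (discreteH1 (Field.absoluteGaloisGroup K) M) :=
  ⨅ (v : HeightOneSpectrum (𝓞 K)) (_ : v ∉ S), ⨅ 𝔓 ∈ v.primesAbove, unramifiedKer M 𝔓

variable {M}

/-- Membership in `H¹(G_K, M; S)`: unramified at all primes above all finite places outside `S`.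
Silverman, *AEC*, X.§4, Lemma 4.3. [folklore] -/
theorem mem_h1Unramified_iff {S : Set (HeightOneSpectrum (𝓞 K))}
    {c : discreteH1 (Field.absoluteGaloisGroup K) M} :
    c ∈ h1Unramified M S ↔
      ∀ v : HeightOneSpectrum (𝓞 K), v ∉ S → ∀ 𝔓 ∈ v.primesAbove, c ∈ unramifiedKer M 𝔓 := by
  simp only [h1Unramified, AddSubgroup.mem_iInf]

variable (M)

/-- `H¹(G_K, M; S)` grows with `S`. Silverman, *AEC*, X.§4 (proof of Lemma 4.3: "we may increase
the set `S`"). [folklore] -/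
theorem h1Unramified_mono {S T : Set (HeightOneSpectrum (𝓞 K))} (hST : S ⊆ T) :
    h1Unramified M S ≤ h1Unramified M T := fun _ hc ↦
  mem_h1Unramified_iff.2 fun v hv 𝔓 h𝔓 ↦ mem_h1Unramified_iff.1 hc v (fun h ↦ hv (hST h)) 𝔓 h𝔓

/-- With no condition imposed, `H¹(G_K, M; all places) = H¹(G_K, M)`. [folklore] -/
@[simp]
theorem h1Unramified_univ : h1Unramified M (Set.univ : Set (HeightOneSpectrum (𝓞 K))) = ⊤ :=
  eq_top_iff.2 fun _ _ ↦ mem_h1Unramified_iff.2 fun _ hv ↦ (hv (Set.mem_univ _)).elim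

variable (K)

/-- **Silverman, AEC Lemma X.4.3.** Let `K` be a number field, `M` a finite (discrete) `G_K`-module
with continuous action, and `S` a finite set of places. Then
`H¹(G_{K̄/K}, M; S) = {ξ ∈ H¹(G_{K̄/K}, M) : ξ unramified outside S}` is finite.
(Proof in the source: inflation–restriction reduces to trivial action; then
`Hom(G_K, M; S) = Hom(G_{L/K}, M)` for `L` the maximal abelian extension of exponent `m = exp M`
unramified outside `S`, finite by VIII.1.6.) Named fact (D-0014); the module is quantified inside,
usage `(h : Literature.finite_h1Unramified K)` then `h M hS`.
[cite: SilvermanAEC2009, Lemma X.4.3] -/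
def finite_h1Unramified : Prop :=
  ∀ [NumberField K] (M : Type u) [AddCommGroup M] [DistribMulAction (Field.absoluteGaloisGroup K) M]
    [TopologicalSpace M] [DiscreteTopology M] [Finite M]
    [ContinuousSMul (Field.absoluteGaloisGroup K) M] {S : Set (HeightOneSpectrum (𝓞 K))},
    S.Finite → Finite (h1Unramified M S)

end Unramified

end Literature.NumberTheory.EllipticCurves

namespace WeierstrassCurve

open Literature.NumberTheory.EllipticCurves Literature.NumberTheory.GaloisRepresentations

variable {K : Type u} [Field K] (W : WeierstrassCurve K)

/-- For an elliptic curve, the Galois action on the geometric `n`-torsion `E[n]` is continuous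
(discrete topology on `E[n]`), granted that stabilisers of geometric points are open
(`isOpen_stabilizer_point`). Silverman, *AEC*, III.§7 and VIII.§1. [folklore] -/
theorem continuousSMul_geomTorsion (hstab : isOpen_stabilizer_point W) (n : ℤ) :
    ContinuousSMul (Field.absoluteGaloisGroup K) (geomTorsion W n) := by
  rw [continuousSMul_iff_stabilizer_isOpen]
  intro P
  convert hstab (P : geomPoints W) using 1
  ext σ
  simp only [SetLike.mem_coe, MulAction.mem_stabilizer_iff, Subtype.ext_iff,
    Literature.NumberTheory.EllipticCurves.AddSubgroup.torsionBy.coe_smul]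

variable [NumberField K]

/-- **Silverman, AEC Cor. X.4.4** (for the isogeny `φ = [n]`, `deg φ = n²`). Let `E/K` be an
elliptic curve over a number field, `n ≠ 0`, and `S` a set of finite places containing every place
of bad reduction of `E` and every finite place `v` with `v(n) > 0`. Then every Selmer class is
unramified outside `S`: `Sel^(n)(E/K) ⊆ H¹(G_{K̄/K}, E[n]; S)`.
(Proof in the source, p. 286: a Selmer class is locally `σ ↦ P^σ − P` with `P ∈ E(K̄_v)`; for
`σ ∈ I_v` its reduction is `Õ`, and `E[n]` injects into `Ẽ_v` for `v ∤ n` of good reduction,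
VIII.1.4.) Here "unramified at `v`" is required at *every* prime `𝔓 ∣ v` of `\bar ℤ_K`
(`Literature.NumberTheory.EllipticCurves.h1Unramified`); the source proves it for an arbitrary extension of `v` to `K̄` and notes
(VIII.§2, Definition p. 191; Exercise B.6) that the condition does not depend on that choice.
Named fact (D-0014). [cite: SilvermanAEC2009, Cor. X.4.4] -/
def selmerGroup_le_h1Unramified : Prop :=
  ∀ [W.IsElliptic] {n : ℤ} (_hn : n ≠ 0) {S : Set (HeightOneSpectrum (𝓞 K))}
    (_hbad : W.badPlaces (𝓞 K) ⊆ S)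
    (_hdiv : ∀ v : HeightOneSpectrum (𝓞 K), (n : 𝓞 K) ∈ v.asIdeal → v ∈ S),
    selmerGroup W n ≤ h1Unramified (geomTorsion W n) S

/-- The set of finite places dividing a nonzero integer `n` is finite (Mathlib's
`Ideal.finite_factors` for the nonzero ideal `(n) ⊆ 𝓞 K`). Silverman, *AEC*, VIII.§1 (the set `S`
of VIII.1.5(b) is finite). [folklore] -/
theorem finite_setOf_intCast_mem_asIdeal {n : ℤ} (hn : n ≠ 0) :
    {v : HeightOneSpectrum (𝓞 K) | (n : 𝓞 K) ∈ v.asIdeal}.Finite := by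
  have h0 : Ideal.span {(n : 𝓞 K)} ≠ ⊥ := by
    rw [Ne, Ideal.span_singleton_eq_bot]
    exact_mod_cast hn
  convert Ideal.finite_factors h0 using 1
  ext v
  simp only [Set.mem_setOf_eq, Ideal.dvd_span_singleton]

/-- **Silverman, AEC Thm. X.4.2(b), assembled from its two printed steps.** Granted Lemma X.4.3
(`Literature.finite_h1Unramified K`) and Cor. X.4.4 (`selmerGroup_le_h1Unramified W`), together with the
named facts that the set of bad places of an elliptic curve is finite (`finite_badPlaces`), that
`E[n]` is finite for `n ≠ 0` (`finite_torsionPoints`, AEC III.6.4) and that `E(K̄)` is a discrete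
`G_K`-module (`isOpen_stabilizer_point`), the `n`-Selmer group `Sel^(n)(E/K)` is finite for every
`n ≠ 0`: it is a subgroup of `H¹(G_K, E[n]; S)` for the finite set
`S = {bad places} ∪ {v : v(n) > 0}`. [cite: SilvermanAEC2009, Thm. X.4.2(b) (proof, pp. 286–287)] -/
theorem finite_selmerGroup_of_le_h1Unramified (h43 : finite_h1Unramified K)
    (h44 : W.selmerGroup_le_h1Unramified) (hbad : W.finite_badPlaces (𝓞 K))
    (htors : finite_torsionPoints W (AlgebraicClosure K)) (hstab : isOpen_stabilizer_point W) :
    W.finite_selmerGroup := by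
  intro _ n hn
  let S : Set (HeightOneSpectrum (𝓞 K)) :=
    W.badPlaces (𝓞 K) ∪ {v | (n : 𝓞 K) ∈ v.asIdeal}
  have hS : S.Finite := hbad.union (finite_setOf_intCast_mem_asIdeal hn)
  haveI : Finite (geomTorsion W n) := htors hn
  haveI : ContinuousSMul (Field.absoluteGaloisGroup K) (geomTorsion W n) :=
    continuousSMul_geomTorsion W hstab n
  have hfin : Finite (h1Unramified (geomTorsion W n) S) := h43 _ hS
  exact @Finite.of_injective _ _ hfin _
    (AddSubgroup.inclusion_injective
      (h44 hn Set.subset_union_left fun v hv ↦ Set.mem_union_right _ hv))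

end WeierstrassCurve
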